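import Summits.AtomisticToContinuum.Crystallization.Theorems.HullExactificationCascadeRobustBarlowTemplateTransportSteps1
import Summits.AtomisticToContinuum.Crystallization.Theorems.HullExactificationCascadeRobustBarlowTemplateTransportGlobalA
import Summits.AtomisticToContinuum.Crystallization.Theorems.HullExactificationCascadeRobustBarlowTemplateTransportGlobalB
import Summits.AtomisticToContinuum.Crystallization.Theorems.PalmUnimodularRigidityShellsToBarlowChartTransportGlobalC

/-!
# Line `registered` (crux `RobustBarlowTemplate`, stmt-AtomisticToContinuum-12088): all layers of the development

Helper lemmas for `develop_transport` (the geometric half of the development): frames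
`⟨x, t₁, t₂, U⟩` read in the scale-relative integer charts `IsZChart` of an everywhere-good
configuration, their transports and the coherence of the resulting development `frameAt`.  The
only metric inputs are the chart transfer lemma `develop_transfer` and `bond_nb_iff`; everything
else is label combinatorics in `ℤ³` (pattern facts `TransportPatterns*` of the sibling crux 9227,
imported verbatim).  All `[folklore]` (HalesDSP2012 §1.3 for the two kissing patterns).

PORT of `PalmUnimodularRigidityShellsToBarlowChartTransportGlobalC.lean` (closed sibling crux
`ShellsToBarlowChart`, stmt-9227) to the SCALE-RELATIVE shell relation `y ∈ shell S x` and the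
five-argument charts `IsZChart S x P A nbr` of this crux; the port rules (conjunct paths,
`bond a b ↦ b ∈ shell S a`, the threaded symmetry hypothesis `hsy` replacing `bond_symm`,
`zchart_transfer` / `zchart_sqNormInt_eq`, the `open … hiding …` line) are listed under
"Port notes" in `…RobustBarlowTemplateTransportSteps1.lean` (and `…Steps6`, `…Attach1`, `…GlobalD`,
`…GlobalA`, `…GlobalB`).

## Port notes (this part: `TransportGlobalC`)
* the signature of `layers` is parallel to the source with `hsy` inserted right after `hch`
  (passed on to `layer_zero`, `layer_up`, `layer_down`); otherwise the proof is the source proof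
  verbatim (no bond occurs in this part);
* the two CHART-AGNOSTIC lemmas of the source part (`frameAt_natSucc`, `frameAt_negSucc`: pure
  `frameAt` / `zIter` statements) are NOT re-proved (the gate forbids restating landed
  declarations): they are used from the source module `…ShellsToBarlowChartTransportGlobalC`,
  imported for that purpose; since that import makes the 9227 `GlobalA`, `GlobalB`, `GlobalC`
  visible, the `open … hiding …` line (the union of those of our `…TransportGlobalA` and
  `…TransportGlobalB`) is EXTENDED by the 9227 names `back_I`, `back_J`, `nbhd`, `layer_up`,
  `layer_down`, `layers` — copy this longer line into later parts that import this one;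
* imports: our parts 1, `GlobalA`, `GlobalB` (as in the source) and the 9227 `GlobalC`;
* the anchor at the end (explicit-`∀` form of the membership conjunct of `layers`, registered
  sub-goal) is new.
-/

noncomputable section

namespace Summit.AtomisticToContinuum.Crystallization.Theorems.HullExactificationCascadeRobustBarlowTemplate

open Literature.Geometry.DiscreteGeometry Literature.MathematicalPhysics.StatisticalMechanics
open Summit.AtomisticToContinuum.Crystallization.Theorems.PalmUnimodularRigidityShellsToBarlowChart hiding
  IsZChart TransportSystem scales_tied sqNormInt_transfer bond_symm nb_mem zlab_spec zlab_nb bond_nb_iff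
  pattern_cases transfer_nb_nb transfer_nb_centre transfer_nb_target sqNormInt_zlab_centre hcp_of_mirror_pair
  Istep_spec Jstep_spec IinvStep_spec JinvStep_spec capWithAny_of_mem_cap IinvStep_Istep Istep_IinvStep
  JinvStep_Jstep Jstep_JinvStep polar_at_apex onesided_at_apex nb_inj Istep_lower Jstep_lower
  IinvStep_lower JinvStep_lower Vstep_spec polar_at_lower_apex onesided_at_lower_apex VinvStep_spec
  attach_I_even attach_I_odd attach_lower_I_pos attach_lower_I_neg attach_J_even attach_J_odd
  Vstep_Istep_pt Vstep_Istep_back Vstep_Istep_side Vstep_Jstep_pt Vstep_Istep_comm Vstep_Jstep_comm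
  attach_lower_J_pos attach_lower_J_neg VinvStep_Istep_pt VinvStep_Jstep_pt VinvStep_Istep_back
  VinvStep_Istep_side Istep_Jstep_comm line_I line_J adm_transports layer_zero back_I back_J nbhd
  layer_up layer_down layers

variable {S : Set (EuclideanSpace ℝ (Fin 3))} {Pc : (EuclideanSpace ℝ (Fin 3)) → Finset (Fin 3 → ℤ)}
  {Ac : (EuclideanSpace ℝ (Fin 3)) → ((EuclideanSpace ℝ (Fin 3)) →ₗᵢ[ℝ] (EuclideanSpace ℝ (Fin 3)))} {nb : (EuclideanSpace ℝ (Fin 3)) → (Fin 3 → ℤ) → (EuclideanSpace ℝ (Fin 3))}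

/-- **All layers of the development are valid and coherent**, and the letters match across
layers: the letter read below layer `n+1` is the parity of layer `n`, the parity of layer
`−(m+1)` is the letter read below layer `−m`. [folklore] -/
theorem layers (hch : ∀ z ∈ S, IsZChart S z (Pc z) (Ac z) (nb z))
    (hsy : ∀ x ∈ S, ∀ y ∈ shell S x, x ∈ shell S y) {g₀ : ZFrame}
    (h₀ : IsFrame (Pc g₀.pt) g₀.t₁ g₀.t₂ g₀.U) (h₀S : g₀.pt ∈ S) (h₀p : frameParity g₀.t₁ g₀.t₂ g₀.U = 1)
    (h₀A : (∀ z ∈ S, Pc z = fcc3Int) ∨ Pc g₀.pt = hcpInt) :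
    (∀ k i j : ℤ, IsFrame (Pc (frameAt Pc nb g₀ k i j).pt) (frameAt Pc nb g₀ k i j).t₁ (frameAt Pc nb g₀ k i j).t₂
        (frameAt Pc nb g₀ k i j).U) ∧
    (∀ k i j : ℤ, (frameAt Pc nb g₀ k i j).pt ∈ S) ∧
    (∀ k i j : ℤ, frameAt Pc nb g₀ k (i + 1) j = Istep Pc nb (frameAt Pc nb g₀ k i j)) ∧
    (∀ k i j : ℤ, frameAt Pc nb g₀ k i (j + 1) = Jstep Pc nb (frameAt Pc nb g₀ k i j)) ∧
    (∀ (n : ℕ) (i j : ℤ), lowerParity (frameAt Pc nb g₀ ((n : ℤ) + 1) i j).t₁ (frameAt Pc nb g₀ ((n : ℤ) + 1) i j).t₂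
        (lowerCap (Pc (frameAt Pc nb g₀ ((n : ℤ) + 1) i j).pt) (frameAt Pc nb g₀ ((n : ℤ) + 1) i j).t₁
          (frameAt Pc nb g₀ ((n : ℤ) + 1) i j).t₂ (frameAt Pc nb g₀ ((n : ℤ) + 1) i j).U) =
        frameParity (frameAt Pc nb g₀ n i j).t₁ (frameAt Pc nb g₀ n i j).t₂ (frameAt Pc nb g₀ n i j).U) ∧
    (∀ (m : ℕ) (i j : ℤ), frameParity (frameAt Pc nb g₀ (-((m : ℤ) + 1)) i j).t₁ (frameAt Pc nb g₀ (-((m : ℤ) + 1)) i j).t₂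
        (frameAt Pc nb g₀ (-((m : ℤ) + 1)) i j).U =
        lowerParity (frameAt Pc nb g₀ (-(m : ℤ)) i j).t₁ (frameAt Pc nb g₀ (-(m : ℤ)) i j).t₂
          (lowerCap (Pc (frameAt Pc nb g₀ (-(m : ℤ)) i j).pt) (frameAt Pc nb g₀ (-(m : ℤ)) i j).t₁
            (frameAt Pc nb g₀ (-(m : ℤ)) i j).t₂ (frameAt Pc nb g₀ (-(m : ℤ)) i j).U)) := by
  -- the layer predicate
  let OK : ℤ → Prop := fun k =>
    (∀ i j : ℤ, IsFrame (Pc (frameAt Pc nb g₀ k i j).pt) (frameAt Pc nb g₀ k i j).t₁ (frameAt Pc nb g₀ k i j).t₂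
        (frameAt Pc nb g₀ k i j).U) ∧
    (∀ i j : ℤ, (frameAt Pc nb g₀ k i j).pt ∈ S) ∧
    (∀ i j : ℤ, frameAt Pc nb g₀ k (i + 1) j = Istep Pc nb (frameAt Pc nb g₀ k i j)) ∧
    (∀ i j : ℤ, frameAt Pc nb g₀ k i (j + 1) = Jstep Pc nb (frameAt Pc nb g₀ k i j))
  have h0 : OK 0 := by
    obtain ⟨a, b, c, d, -⟩ := layer_zero (Pc := Pc) (nb := nb) hch hsy h₀ h₀S h₀p h₀A
    exact ⟨a, b, c, d⟩
  have hup : ∀ n : ℕ, OK n → OK ((n : ℤ) + 1) ∧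
      ∀ i j : ℤ, lowerParity (frameAt Pc nb g₀ ((n : ℤ) + 1) i j).t₁ (frameAt Pc nb g₀ ((n : ℤ) + 1) i j).t₂
        (lowerCap (Pc (frameAt Pc nb g₀ ((n : ℤ) + 1) i j).pt) (frameAt Pc nb g₀ ((n : ℤ) + 1) i j).t₁
          (frameAt Pc nb g₀ ((n : ℤ) + 1) i j).t₂ (frameAt Pc nb g₀ ((n : ℤ) + 1) i j).U) =
        frameParity (frameAt Pc nb g₀ n i j).t₁ (frameAt Pc nb g₀ n i j).t₂ (frameAt Pc nb g₀ n i j).U := by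
    rintro n ⟨a, b, c, d⟩
    obtain ⟨a', b', c', d', e'⟩ := layer_up hch hsy (Φ := fun i j => frameAt Pc nb g₀ n i j) a b c d
    refine ⟨⟨fun i j => ?_, fun i j => ?_, fun i j => ?_, fun i j => ?_⟩, fun i j => ?_⟩
    · rw [frameAt_natSucc]; exact a' i j
    · rw [frameAt_natSucc]; exact b' i j
    · rw [frameAt_natSucc, frameAt_natSucc]; exact c' i j
    · rw [frameAt_natSucc, frameAt_natSucc]; exact d' i j
    · rw [frameAt_natSucc]; exact e' i j
  have hdown : ∀ m : ℕ, OK (-(m : ℤ)) → OK (-((m : ℤ) + 1)) ∧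
      ∀ i j : ℤ, frameParity (frameAt Pc nb g₀ (-((m : ℤ) + 1)) i j).t₁ (frameAt Pc nb g₀ (-((m : ℤ) + 1)) i j).t₂
        (frameAt Pc nb g₀ (-((m : ℤ) + 1)) i j).U =
        lowerParity (frameAt Pc nb g₀ (-(m : ℤ)) i j).t₁ (frameAt Pc nb g₀ (-(m : ℤ)) i j).t₂
          (lowerCap (Pc (frameAt Pc nb g₀ (-(m : ℤ)) i j).pt) (frameAt Pc nb g₀ (-(m : ℤ)) i j).t₁
            (frameAt Pc nb g₀ (-(m : ℤ)) i j).t₂ (frameAt Pc nb g₀ (-(m : ℤ)) i j).U) := by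
    rintro m ⟨a, b, c, d⟩
    obtain ⟨a', b', c', d', e'⟩ := layer_down hch hsy (Φ := fun i j => frameAt Pc nb g₀ (-(m : ℤ)) i j) a b c d
    refine ⟨⟨fun i j => ?_, fun i j => ?_, fun i j => ?_, fun i j => ?_⟩, fun i j => ?_⟩
    · rw [frameAt_negSucc]; exact a' i j
    · rw [frameAt_negSucc]; exact b' i j
    · rw [frameAt_negSucc, frameAt_negSucc]; exact c' i j
    · rw [frameAt_negSucc, frameAt_negSucc]; exact d' i j
    · rw [frameAt_negSucc]; exact e' i j
  have hnat : ∀ n : ℕ, OK n := by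
    intro n; induction n with
    | zero => exact h0
    | succ m ih => have := (hup m ih).1; push_cast; exact this
  have hneg : ∀ m : ℕ, OK (-(m : ℤ)) := by
    intro m; induction m with
    | zero => simpa using h0
    | succ m ih => have := (hdown m ih).1; push_cast; exact this
  have hall : ∀ k : ℤ, OK k := by
    intro k
    rcases int_cases k with ⟨n, rfl⟩ | ⟨n, rfl⟩
    · exact hnat n
    · have := hneg (n + 1); push_cast at this; exact this
  exact ⟨fun k => (hall k).1, fun k => (hall k).2.1, fun k => (hall k).2.2.1, fun k => (hall k).2.2.2,
    fun n => (hup n (hnat n)).2, fun m => (hdown m (hneg m)).2⟩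

/-! ## Anchor -/

/-- Anchor (registered sub-goal of stmt-AtomisticToContinuum-12088, toward `develop_transport`):
every site of the development `frameAt g₀ k i j` of an admissible frame lies in `S` (explicit
form of the membership conjunct of `layers`). [folklore] -/
theorem transportGlobalC_anchor : ∀ (S : Set (EuclideanSpace ℝ (Fin 3))) (Pc : EuclideanSpace ℝ (Fin 3) → Finset (Fin 3 → ℤ)) (Ac : EuclideanSpace ℝ (Fin 3) → (EuclideanSpace ℝ (Fin 3) →ₗᵢ[ℝ] EuclideanSpace ℝ (Fin 3))) (nb : EuclideanSpace ℝ (Fin 3) → (Fin 3 → ℤ) → EuclideanSpace ℝ (Fin 3)), (∀ z ∈ S, IsZChart S z (Pc z) (Ac z) (nb z)) → (∀ x ∈ S, ∀ y ∈ shell S x, x ∈ shell S y) → ∀ g₀ : ZFrame, IsFrame (Pc g₀.pt) g₀.t₁ g₀.t₂ g₀.U → g₀.pt ∈ S → frameParity g₀.t₁ g₀.t₂ g₀.U = 1 → ((∀ z ∈ S, Pc z = fcc3Int) ∨ Pc g₀.pt = hcpInt) → ∀ k i j : ℤ, (frameAt Pc nb g₀ k i j).pt ∈ S :=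
  fun _ _ _ _ hch hsy _ h₀ h₀S h₀p h₀A k i j => (layers hch hsy h₀ h₀S h₀p h₀A).2.1 k i j

end Summit.AtomisticToContinuum.Crystallization.Theorems.HullExactificationCascadeRobustBarlowTemplate

end
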